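import Summits.BirchSwinnertonDyer.Rank1Residual.Partition
import Summits.BirchSwinnertonDyer.Rank1Residual.X9.SurjBigImage
import HarnessLib

/-!
# The named corners are DECIDABLE: a Boolean function of the finite grid cell, and the complement is
# covered by `decide` (cell `b2b-bsdres`, RESIDUAL-MAP.md §A/§B/§C CORNER PREDICATES; coordinator
# ruling (A) 2026-08-20T22:2xZ: "excluded corners are explicit, decidable predicates on (E, p)")

HONEST FRAMING (run/shared/lean/b2b/bsd-rank1-residual/, verbatim in every file): the goal of the
cell is to DELETE the COMBINATION-SHAPED residual classes of the Birch–Swinnerton-Dyer formula for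
ALL analytic-rank `≤ 1` elliptic curves over `ℚ` — "full BSD formula for every rank `≤ 1` curve in
class `C`" assembled STRICTLY from published theorems — so that the rank-`≤ 1` remainder becomes
exactly the CONSTRUCTION-SHAPED classes, which are TYPED (missing-input `Prop`s), NOT attempted.
This is not "finishing BSD". Theorems and Boolean bookkeeping definitions only; NO named fact, NO
Literature statement; nothing about any particular curve is asserted; no label changes.

What this file adds to `Partition/Corners.lean` (rmap-1 gen 2: `bsdp_of_not_corner`, the STRONG
PARTIAL THEOREM outside the eight named corners X1 / X9 / X10∧¬surj / X6∧r=0 / X7 / X8 / X11a / X2):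
the SAME exclusion read on the FINITE GRID of the partition lemma (`Partition/Grid.lean`, 36 864
cells). (1) `Cell.corner` — the eight corners as ONE Boolean function of a cell (`cornerA` good
ordinary axis §A, `cornerB` supersingular axis §B, `cornerC` multiplicative axis §C), next to the
headline's domain `Cell.headlineDomain` (`¬cm ∧ p odd ∧ (good ∨ (mult ∧ r = 0))`) and the Serre
constraint `Cell.serreConsistent` (`surj ∧ p ≥ 5 ⇒ (im)`, true on every real pair by the x9 seat's
`X9.bigIm_of_surj`). (2) `Cell.covered_of_not_corner` — checked by `decide +kernel` over the whole
grid: every consistent, Serre-consistent cell of the domain outside the corner satisfies the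
Boolean hypotheses of one of the class-level COVERED rows C1/C2/C3/C6/C7/C16 (the table of
`Partition/Bsdp.lean`). (3) On a real pair the Boolean corner is implied by — and, disjunct by
disjunct, reflects — the `Prop` corners of `Corners.lean` (`cellOf_corner_false_of_not_corners`,
from part 4's atom lemmas and `xHolds_of_cell`; `cellOf_corner_iff`), so (4) `covered_of_not_corners`
derives THROUGH THE TABLE that outside the corners a class-level COVERED ROW applies: `(E, p)` ↦
`cellOf W p` ↦ not a corner cell ↦ a covered cell (finite check) ↦ `Covered W p` (`covered_of_cell`);
`Partition/Bsdp.lean`'s `bsdp_of_covered` (the fourteen named published facts; PUB\* flags travel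
with `hBCS` / `hJSW` / `hYZ`) then gives back `Corners.bsdp_of_not_corner` verbatim (not restated
here: the gate's dedup rule; `covered_of_not_corners` is the strictly finer statement). In words: whether
`(E, p)` lies in an excluded corner is decided by the thirteen finite atoms of its grid cell
(RESIDUAL-MAP §A RMAP NOTE rmap-1 g3, 2026-08-21T00:28Z: each atom is a finite computation stored
per pair by the census, two engines), and outside the corners the kernel's finite table — not a
case analysis written by hand — certifies that a published row applies.

References: RESIDUAL-MAP.md §A/§B/§C CORNER PREDICATES and §I HEADLINE; HOME/PARTITION.md §3–§4;
`Partition/Grid.lean`, `Partition/Table.lean`, `Partition/CellOf.lean`, `Partition.lean`,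
`Partition/Bsdp.lean`, `Partition/Corners.lean`, `X9/SurjBigImage.lean`.
-/

namespace Summit.BirchSwinnertonDyer.Rank1Residual

namespace Cell

variable (c : Cell)

/-! ## §1 The corners, the domain and the Serre constraint at cell level -/

/-- CORNER_A (RESIDUAL-MAP §A; good ORDINARY axis): X1 ∨ X9 ∨ (X10 ∧ ¬surj) = Eisenstein anomalous
∨ small irreducible image at `p ∈ {5, 7}` ∨ image `3Ns/3Nn` at `p = 3`. [folklore] -/
def cornerA : Bool := c.x1 || c.x9 || (c.x10 && !c.surj)

/-- CORNER_B (RESIDUAL-MAP §B; good SUPERSINGULAR axis): (X6 ∧ r = 0) ∨ X7 ∨ X8. [folklore] -/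
def cornerB : Bool := (c.x6 && c.r0) || c.x7 || c.x8

/-- CORNER_C (RESIDUAL-MAP §C; MULTIPLICATIVE axis, rank 0): X11a ∨ X2. [folklore] -/
def cornerC : Bool := c.x11a || c.x2

/-- The eight named corners of the strong partial theorem, as one Boolean function of the cell.
[folklore] -/
def corner : Bool := c.cornerA || c.cornerB || c.cornerC

/-- The headline's domain at cell level: non-CM, `p` odd, and `p` good or (`p` multiplicative and
`r = 0`). [folklore] -/
def headlineDomain : Bool := !c.cm && c.odd && (c.good || (c.mult && c.r0))

/-- Serre's constraint `surj(p) ∧ p ≥ 5 ⇒ (im)` (every real pair satisfies it: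
`X9.bigIm_of_surj`; it closes the partition lemma's finding F2). [folklore] -/
def serreConsistent : Bool := !(c.surj && c.ge5) || c.bigIm

/-- The specification checked on the grid: a consistent, Serre-consistent domain cell outside the
corner is covered by a class-level row. [folklore] -/
def cornerSpec : Bool :=
  !(c.consistent && c.serreConsistent && c.headlineDomain && !c.corner) || c.covered

/-! ## §2 The finite verification -/

/-- Raw form over the grid coordinates (the shape the kernel evaluates). [folklore] -/
theorem cornerSpec_raw :
    ∀ (pk : PK) (red : RedK) (im : ImK) (bigIm : Bool) (rk : RK)
      (cm ram sst anom gvpar a3zero cmSplit cmRam : Bool),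
      (Cell.mk pk red im bigIm rk cm ram sst anom gvpar a3zero cmSplit cmRam).cornerSpec = true := by
  decide +kernel

/-- `cornerSpec` holds on all 36 864 cells. [folklore] -/
theorem cornerSpec_holds (c : Cell) : c.cornerSpec = true := by
  obtain ⟨pk, red, im, bigIm, rk, cm, ram, sst, anom, gvpar, a3zero, cmSplit, cmRam⟩ := c
  exact cornerSpec_raw ..

/-- **Outside the corner every consistent domain cell is a covered cell** (finite check).
[folklore] -/
theorem covered_of_not_corner (c : Cell) (hc : c.consistent = true) (hs : c.serreConsistent = true)
    (hd : c.headlineDomain = true) (hn : c.corner = false) : c.covered = true := by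
  have h := cornerSpec_holds c
  simp only [cornerSpec, hc, hs, hd, hn, Bool.not_false, Bool.and_self, Bool.not_true,
    Bool.false_or] at h
  exact h

end Cell

/-! ## §3 Binding to curves -/

section Curve

open WeierstrassCurve Literature.NumberTheory.EllipticCurves
  Literature.NumberTheory.EllipticCurves.Rank1Residual

variable {W : WeierstrassCurve ℚ} [W.IsElliptic] [W.IsGloballyMinimal] {p : ℕ} [Fact p.Prime]

/-- Every real pair is Serre-consistent: `surj(p) ∧ p ≥ 5 ⇒ (im)` (`X9.bigIm_of_surj`). [folklore] -/
theorem cellOf_serreConsistent : (cellOf W p).serreConsistent = true := by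
  simp only [Cell.serreConsistent, Bool.or_eq_true, Bool.not_eq_true', Bool.and_eq_false_imp]
  by_cases hb : BigIm W p
  · exact Or.inr ((cellOf_bigIm W p).2 hb)
  · refine Or.inl fun hs => ?_
    rw [Bool.eq_false_iff]
    intro h5
    exact hb (X9.bigIm_of_surj W p ((cellOf_ge5 W p).1 h5) ((cellOf_surj W p).1 hs))

/-- The headline's domain, cell ⇐ curve. [folklore] -/
theorem cellOf_headlineDomain (hcm : ¬ W.HasCM) (hp : p ≠ 2)
    (hdom : Good W p ∨ (Mult W p ∧ W.analyticRank = 0)) : (cellOf W p).headlineDomain = true := by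
  simp only [Cell.headlineDomain, Bool.and_eq_true, Bool.or_eq_true, Bool.not_eq_true']
  refine ⟨⟨(cellOf_cm_false W p).2 hcm, (cellOf_odd W p).2 hp⟩, ?_⟩
  rcases hdom with hg | ⟨hm, hr0⟩
  · exact Or.inl ((cellOf_good W p).2 hg)
  · exact Or.inr ⟨(cellOf_mult W p).2 hm, (cellOf_r0 W p).2 hr0⟩

/-- **The Boolean corner reflects the named corners**: if `(E, p)` avoids the eight `Prop` corners
of `Corners.lean`, its cell is not a corner cell (each Boolean disjunct reflects to its class by
part 4's `xHolds_of_cell` and the atom lemmas `cellOf_surj_false` / `cellOf_r0`). [folklore] -/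
theorem cellOf_corner_false_of_not_corners (hr : W.analyticRank ≤ 1)
    (hX1 : ¬ ClassX1 W p) (hX9 : ¬ ClassX9 W p) (hX10b : ¬ (ClassX10 W p ∧ ¬ Surj W p))
    (hX6 : ¬ (ClassX6 W p ∧ W.analyticRank = 0)) (hX7 : ¬ ClassX7 W p) (hX8 : ¬ ClassX8 W p)
    (hX11a : ¬ ClassX11a W p) (hX2 : ¬ ClassX2 W p) : (cellOf W p).corner = false := by
  rw [Bool.eq_false_iff]
  intro h
  simp only [Cell.corner, Cell.cornerA, Cell.cornerB, Cell.cornerC, Bool.or_eq_true] at h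
  rcases h with (((h1 | h9) | h10) | ((h6 | h7) | h8)) | (h11a | h2)
  · exact hX1 (xHolds_of_cell hr .X1 h1)
  · exact hX9 (xHolds_of_cell hr .X9 h9)
  · rw [Bool.and_eq_true, Bool.not_eq_true'] at h10
    exact hX10b ⟨xHolds_of_cell hr .X10 h10.1, (cellOf_surj_false W p).1 h10.2⟩
  · rw [Bool.and_eq_true] at h6
    exact hX6 ⟨xHolds_of_cell hr .X6 h6.1, (cellOf_r0 W p).1 h6.2⟩
  · exact hX7 (xHolds_of_cell hr .X7 h7)
  · exact hX8 (xHolds_of_cell hr .X8 h8)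
  · exact hX11a (xHolds_of_cell hr .X11a h11a)
  · exact hX2 (xHolds_of_cell hr .X2 h2)

/-! ### Curve ⇒ cell, class by class (the converse reflection for the eight corner classes) -/

/-- X1 ⇒ `x1`. [folklore] -/
theorem cellOf_x1_of_classX1 (h : ClassX1 W p) : (cellOf W p).x1 = true := by
  obtain ⟨hgt, hred, hgood, hanom, hn⟩ := h
  simp only [Cell.x1, (cellOf_gt2 W p).2 hgt, (cellOf_isRed W p).2 hred, (cellOf_good W p).2 hgood,
    (cellOf_anom W p).2 hanom, Bool.true_and, Bool.not_eq_true', Bool.and_eq_false_imp]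
  intro h0
  exact (cellOf_gvpar_false W p).2 fun hg => hn ⟨(cellOf_r0 W p).1 h0, hg⟩

/-- X9 ⇒ `x9`. [folklore] -/
theorem cellOf_x9_of_classX9 (hr : W.analyticRank ≤ 1) (h : ClassX9 W p) : (cellOf W p).x9 = true := by
  obtain ⟨hcm, hord, h5, hirr, hns, himp⟩ := h
  simp only [Cell.x9, (cellOf_cm_false W p).2 hcm, (cellOf_goodOrd W p).2 hord, (cellOf_ge5 W p).2 h5,
    (cellOf_irr W p).2 hirr, (cellOf_surj_false W p).2 hns, Bool.not_false,
    Bool.true_and, Bool.not_eq_true', Bool.and_eq_false_imp]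
  intro h1
  exact (cellOf_sst_false W p).2 (himp ((cellOf_r1 W p hr).1 h1))

/-- X10 ⇒ `x10`. [folklore] -/
theorem cellOf_x10_of_classX10 (hr : W.analyticRank ≤ 1) (h : ClassX10 W p) :
    (cellOf W p).x10 = true := by
  obtain ⟨h3, hord, hirr, hor⟩ := h
  subst h3
  simp only [Cell.x10, (cellOf_isThree W 3).2 rfl, (cellOf_goodOrd W 3).2 hord, (cellOf_irr W 3).2 hirr,
    Bool.true_and, Bool.or_eq_true, Bool.and_eq_true, Bool.not_eq_true']
  rcases hor with ⟨h0, hnr⟩ | ⟨h1, hns⟩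
  · exact Or.inl ⟨(cellOf_r0 W 3).2 h0, (cellOf_ram_false W 3).2 hnr⟩
  · exact Or.inr ⟨(cellOf_r1 W 3 hr).2 h1, (cellOf_sst_false W 3).2 hns⟩

/-- X6 ⇒ `x6`. [folklore] -/
theorem cellOf_x6_of_classX6 (h : ClassX6 W p) : (cellOf W p).x6 = true := by
  obtain ⟨hss, hsst, hor⟩ := h
  simp only [Cell.x6, (cellOf_goodSS W p).2 hss, (cellOf_sst W p).2 hsst, Bool.true_and,
    Bool.or_eq_true]
  rcases hor with h5 | ha
  · exact Or.inl ((cellOf_ge5 W p).2 h5)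
  · exact Or.inr ((cellOf_a3zero W p).2 ha)

/-- X7 ⇒ `x7`. [folklore] -/
theorem cellOf_x7_of_classX7 (h : ClassX7 W p) : (cellOf W p).x7 = true := by
  simp only [Cell.x7, (cellOf_goodSS W p).2 h.1, (cellOf_sst_false W p).2 h.2, Bool.not_false,
    Bool.and_self]

/-- X8 ⇒ `x8`. [folklore] -/
theorem cellOf_x8_of_classX8 (h : ClassX8 W p) : (cellOf W p).x8 = true := by
  obtain ⟨h3, hss, ha⟩ := h
  subst h3
  simp only [Cell.x8, (cellOf_isThree W 3).2 rfl, (cellOf_goodSS W 3).2 hss,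
    (cellOf_a3zero_false W 3).2 ha, Bool.not_false, Bool.and_self]

/-- X11a ⇒ `x11a`. [folklore] -/
theorem cellOf_x11a_of_classX11a (h : ClassX11a W p) : (cellOf W p).x11a = true := by
  obtain ⟨h0, hp, hm, hirr, hnr⟩ := h
  simp only [Cell.x11a, (cellOf_r0 W p).2 h0, (cellOf_odd W p).2 hp, (cellOf_mult W p).2 hm,
    (cellOf_irr W p).2 hirr, (cellOf_ram_false W p).2 hnr, Bool.not_false, Bool.and_self]

/-- X2 ⇒ `x2`. [folklore] -/
theorem cellOf_x2_of_classX2 (h : ClassX2 W p) : (cellOf W p).x2 = true := by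
  obtain ⟨hp, hred, hm⟩ := h
  simp only [Cell.x2, (cellOf_odd W p).2 hp, (cellOf_isRed W p).2 hred, (cellOf_mult W p).2 hm,
    Bool.and_self]

/-- Conversely, each named corner makes the cell a corner cell — so on real pairs of analytic rank
`≤ 1` the Boolean corner is EXACTLY the union of the eight `Prop` corners. [folklore] -/
theorem cellOf_corner_of_corners (hr : W.analyticRank ≤ 1)
    (h : ClassX1 W p ∨ ClassX9 W p ∨ (ClassX10 W p ∧ ¬ Surj W p) ∨
      (ClassX6 W p ∧ W.analyticRank = 0) ∨ ClassX7 W p ∨ ClassX8 W p ∨ ClassX11a W p ∨ ClassX2 W p) :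
    (cellOf W p).corner = true := by
  simp only [Cell.corner, Cell.cornerA, Cell.cornerB, Cell.cornerC, Bool.or_eq_true,
    Bool.and_eq_true, Bool.not_eq_true']
  rcases h with h1 | h9 | ⟨h10, hs⟩ | ⟨h6, h0⟩ | h7 | h8 | h11a | h2
  · exact Or.inl (Or.inl (Or.inl (Or.inl (cellOf_x1_of_classX1 h1))))
  · exact Or.inl (Or.inl (Or.inl (Or.inr (cellOf_x9_of_classX9 hr h9))))
  · exact Or.inl (Or.inl (Or.inr ⟨cellOf_x10_of_classX10 hr h10, (cellOf_surj_false W p).2 hs⟩))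
  · exact Or.inl (Or.inr (Or.inl (Or.inl ⟨cellOf_x6_of_classX6 h6, (cellOf_r0 W p).2 h0⟩)))
  · exact Or.inl (Or.inr (Or.inl (Or.inr (cellOf_x7_of_classX7 h7))))
  · exact Or.inl (Or.inr (Or.inr (cellOf_x8_of_classX8 h8)))
  · exact Or.inr (Or.inl (cellOf_x11a_of_classX11a h11a))
  · exact Or.inr (Or.inr (cellOf_x2_of_classX2 h2))

/-- **The corner is decidable on real pairs**: `(E, p)` lies in one of the eight named corners iff
its grid cell is a corner cell. [folklore] -/
theorem cellOf_corner_iff (hr : W.analyticRank ≤ 1) :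
    (cellOf W p).corner = true ↔
      (ClassX1 W p ∨ ClassX9 W p ∨ (ClassX10 W p ∧ ¬ Surj W p) ∨
        (ClassX6 W p ∧ W.analyticRank = 0) ∨ ClassX7 W p ∨ ClassX8 W p ∨ ClassX11a W p ∨ ClassX2 W p) := by
  constructor
  · intro h
    by_contra hn
    simp only [not_or] at hn
    obtain ⟨hX1, hX9, hX10b, hX6, hX7, hX8, hX11a, hX2⟩ := hn
    have hf := cellOf_corner_false_of_not_corners hr hX1 hX9 hX10b hX6 hX7 hX8 hX11a hX2
    rw [hf] at h
    exact Bool.false_ne_true h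
  · exact cellOf_corner_of_corners hr

/-- **Outside the named corners the pair's cell is a covered cell** (domain of the headline):
finite table + reflection. [folklore] -/
theorem cellOf_covered_of_not_corners (hr : W.analyticRank ≤ 1) (hcm : ¬ W.HasCM) (hp : p ≠ 2)
    (hdom : Good W p ∨ (Mult W p ∧ W.analyticRank = 0))
    (hX1 : ¬ ClassX1 W p) (hX9 : ¬ ClassX9 W p) (hX10b : ¬ (ClassX10 W p ∧ ¬ Surj W p))
    (hX6 : ¬ (ClassX6 W p ∧ W.analyticRank = 0)) (hX7 : ¬ ClassX7 W p) (hX8 : ¬ ClassX8 W p)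
    (hX11a : ¬ ClassX11a W p) (hX2 : ¬ ClassX2 W p) : (cellOf W p).covered = true :=
  Cell.covered_of_not_corner (cellOf W p) (cellOf_consistent W p) cellOf_serreConsistent
    (cellOf_headlineDomain hcm hp hdom)
    (cellOf_corner_false_of_not_corners hr hX1 hX9 hX10b hX6 hX7 hX8 hX11a hX2)

/-- **Outside the named corners a class-level COVERED row applies** (`Covered W p`: one of C1 / C2 /
C3 / C6 / C7 / C8 / C10 / C16 / C17 with its hypotheses as the tree states them). [folklore] -/
theorem covered_of_not_corners (hr : W.analyticRank ≤ 1) (hcm : ¬ W.HasCM) (hp : p ≠ 2)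
    (hdom : Good W p ∨ (Mult W p ∧ W.analyticRank = 0))
    (hX1 : ¬ ClassX1 W p) (hX9 : ¬ ClassX9 W p) (hX10b : ¬ (ClassX10 W p ∧ ¬ Surj W p))
    (hX6 : ¬ (ClassX6 W p ∧ W.analyticRank = 0)) (hX7 : ¬ ClassX7 W p) (hX8 : ¬ ClassX8 W p)
    (hX11a : ¬ ClassX11a W p) (hX2 : ¬ ClassX2 W p) : Covered W p :=
  covered_of_cell hr (cellOf_covered_of_not_corners hr hcm hp hdom hX1 hX9 hX10b hX6 hX7 hX8 hX11a hX2)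

end Curve

end Summit.BirchSwinnertonDyer.Rank1Residual
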